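import Summits.QuantumFields.YangMills.Theorems.NPointIsotropy.Negative.AngularBandLimitFalse

/-!
# Negative results on `PencilRigidity.NPointIsotropy` (crux-triage r1 / triager 3, gen 2), part A:
# a six-point planar junk family invisible to all eight planar OS frames

Support file for `QuarterTurnPositiveFalse.lean` (refutation of the first lemma `QuarterTurnPositive` of the
crux-idea card `quarter-turn-root`, crux stmt-QuantumFields-11686). Here: the planar six-point configuration
`Z = ((-10,-60), (-10,-50), (-50,-10), (10,20), (30,20), (40,30))` (coordinates `(x₀,x₁)`, `x₂ = x₃ = 0`), which has,
for EACH of the four planar mirror directions `e₀, e₁, e₀+e₁, e₀-e₁`, two points with equal component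
(`exists_pair_Z`); the functional `T` = `W(B₄) × S₆`-symmetrised integral over the diagonal translates of `Z`; and the
one-species family `S6` (`𝔖₆ = -T`, all other degrees `0`), which is symmetric, translation invariant, fully
hypercubic invariant and reflection positive in pull-back form for EVERY frame `R e₀ = a e₀ + b e₁` with
`a = 0 ∨ b = 0 ∨ a² = b²` — with identically vanishing OS forms (`S6_frame_rp`), because `θF* ⊗ G` with `F, G`
time-ordered in the frame lives on configurations with pairwise distinct frame-times.

MECHANISM (complementing the standing disprover's 7-plane junk `J` at `n = 4`, `Negative/JunkFamily.lean`): the typed OS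
clauses never see singular parts of `𝔖ₙ` carried by the codimension-1 sets where two points have EQUAL time in a frame;
a PLANAR configuration is automatically invisible in the twelve non-planar mirror directions, so four equal pairs suffice.
-/

noncomputable section

-- Mathlib's `SimplexCategory` instance `Fintype (Fin (x.len + 1))` matches `Fintype (Fin 4)` (tree-known
-- workaround, as in the other Negative files).
attribute [-instance] SimplexCategory.instFintypeToTypeOrderHomFinHAddNatLenOfNat

namespace Summit.QuantumFields.YangMills.Theorems.NPointIsotropy.Negative.Triage3g2

open scoped BigOperators ComplexConjugate InnerProductSpace
open MeasureTheory Filter Topology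
open Literature.MathematicalPhysics.QuantumLattice Literature.MathematicalPhysics.AQFT
  Literature.MathematicalPhysics.QuantumFieldTheory
open Summit.QuantumFields.YangMills.Theorems.NPointIsotropy.Negative
open Summit.QuantumFields.YangMills.Theorems.NPointIsotropy.Negative.Triage3 (EightFrameRP)

/-! ## §1 Planar points and the six-point configuration `Z` -/

/-- The point `(a, b, 0, 0)` of the `(x₀,x₁)`-plane. -/
def pt (a b : ℝ) : E4 := a • e 0 + b • e 1

/-- Coordinates of a planar point. -/
@[simp] theorem pt_apply (a b : ℝ) (k : Fin 4) :
    pt a b k = if k = 0 then a else if k = 1 then b else 0 := by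
  fin_cases k <;> simp [pt, e]

/-- Pairing a planar point with a vector. -/
theorem inner_pt (a b : ℝ) (m : E4) : ⟪pt a b, m⟫_ℝ = a * m 0 + b * m 1 := by
  simp [pt, e, inner_add_left, real_inner_smul_left, EuclideanSpace.inner_single_left]

/-- **The six-point planar configuration** carrying the junk: `(Θ' Y reversed, X)` for the two bump
triples `Y`, `X` of §4 (`Θ' (a, b) = (-b, -a)` the anti-diagonal mirror). -/
def Z : Fin 6 → E4 := ![pt (-10) (-60), pt (-10) (-50), pt (-50) (-10), pt 10 20, pt 30 20, pt 40 30]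

/-- Point `0` of `Z`. -/
theorem Z0 : Z 0 = pt (-10) (-60) := rfl
/-- Point `1` of `Z`. -/
theorem Z1 : Z 1 = pt (-10) (-50) := rfl
/-- Point `2` of `Z`. -/
theorem Z2 : Z 2 = pt (-50) (-10) := rfl
/-- Point `3` of `Z`. -/
theorem Z3 : Z 3 = pt 10 20 := rfl
/-- Point `4` of `Z`. -/
theorem Z4 : Z 4 = pt 30 20 := rfl
/-- Point `5` of `Z`. -/
theorem Z5 : Z 5 = pt 40 30 := rfl

/-- **Key combinatorics.** For every `m` whose planar part is an axis or a diagonal direction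
(`m 0 = 0 ∨ m 1 = 0 ∨ (m 0)² = (m 1)²`), two points of `Z` have the same pairing with `m`: equal `x₀`
(points 0, 1), equal `x₁` (points 3, 4), equal `x₀ + x₁` (points 1, 2), equal `x₀ - x₁` (points 4, 5). -/
theorem exists_pair_Z (m : E4) (hm : m 0 = 0 ∨ m 1 = 0 ∨ m 0 ^ 2 = m 1 ^ 2) :
    ∃ p q : Fin 6, p ≠ q ∧ ⟪Z p, m⟫_ℝ = ⟪Z q, m⟫_ℝ := by
  rcases hm with h | h | h
  · exact ⟨3, 4, by decide, by rw [Z3, Z4, inner_pt, inner_pt, h]; ring⟩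
  · exact ⟨0, 1, by decide, by rw [Z0, Z1, inner_pt, inner_pt, h]; ring⟩
  · rcases sq_eq_sq_iff_eq_or_eq_neg.1 h with h' | h'
    · exact ⟨1, 2, by decide, by rw [Z1, Z2, inner_pt, inner_pt, h']; ring⟩
    · exact ⟨4, 5, by decide, by rw [Z4, Z5, inner_pt, inner_pt, h']; ring⟩

/-- The `W(B₄)`-preimage of a frame vector `a e₀ + b e₁` with `a = 0 ∨ b = 0 ∨ a² = b²` (the eight planar
frames, and more) satisfies the hypothesis of `exists_pair_Z`. -/
theorem sp_symm_frame (σ : Equiv.Perm (Fin 4)) (ε : Fin 4 → Bool) (a b : ℝ)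
    (hab : a = 0 ∨ b = 0 ∨ a ^ 2 = b ^ 2) :
    let m := (sp σ ε).symm (a • EuclideanSpace.single 0 1 + b • EuclideanSpace.single 1 1)
    m 0 = 0 ∨ m 1 = 0 ∨ m 0 ^ 2 = m 1 ^ 2 := by
  intro m
  have hinj := σ.injective
  by_cases h00 : σ 0 = 0
  · -- then σ 1 ≠ 0
    have h10 : σ 1 ≠ 0 := fun h => absurd (hinj (h.trans h00.symm)) (by decide)
    by_cases h11 : σ 1 = 1
    · have hm0 : m 0 = sgn (ε 0) * a := by simp [m, sp_symm_apply, h00, mul_comm]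
      have hm1 : m 1 = sgn (ε 1) * b := by simp [m, sp_symm_apply, h11, mul_comm]
      rcases hab with ha | hb | hsq
      · left; rw [hm0, ha, mul_zero]
      · right; left; rw [hm1, hb, mul_zero]
      · right; right
        rw [hm0, hm1, mul_pow, mul_pow, sq (sgn _), sgn_mul_self, sq (sgn _), sgn_mul_self, hsq]
    · right; left
      simp [m, sp_symm_apply, h10, h11]
  · by_cases h01 : σ 0 = 1
    · have h11 : σ 1 ≠ 1 := fun h => absurd (hinj (h.trans h01.symm)) (by decide)
      by_cases h10 : σ 1 = 0
      · have hm0 : m 0 = sgn (ε 0) * b := by simp [m, sp_symm_apply, h01, mul_comm]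
        have hm1 : m 1 = sgn (ε 1) * a := by simp [m, sp_symm_apply, h10, mul_comm]
        rcases hab with ha | hb | hsq
        · right; left; rw [hm1, ha, mul_zero]
        · left; rw [hm0, hb, mul_zero]
        · right; right
          rw [hm0, hm1, mul_pow, mul_pow, sq (sgn _), sgn_mul_self, sq (sgn _), sgn_mul_self, hsq]
      · right; left
        simp [m, sp_symm_apply, h10, h11]
    · left
      simp [m, sp_symm_apply, h00, h01]

/-- Frame form: for `R e₀ = a e₀ + b e₁` with `a = 0 ∨ b = 0 ∨ a² = b²`. -/
theorem frame_hw (R : E4 ≃ₗᵢ[ℝ] E4) (a b : ℝ) (hab : a = 0 ∨ b = 0 ∨ a ^ 2 = b ^ 2)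
    (hR : R (EuclideanSpace.single 0 1) = a • EuclideanSpace.single 0 1 + b • EuclideanSpace.single 1 1) :
    ∀ (σ : Equiv.Perm (Fin 4)) (ε : Fin 4 → Bool),
      ((sp σ ε).symm (R (EuclideanSpace.single 0 1))) 0 = 0 ∨
      ((sp σ ε).symm (R (EuclideanSpace.single 0 1))) 1 = 0 ∨
      ((sp σ ε).symm (R (EuclideanSpace.single 0 1))) 0 ^ 2 =
        ((sp σ ε).symm (R (EuclideanSpace.single 0 1))) 1 ^ 2 := by
  intro σ ε
  rw [hR]
  exact sp_symm_frame σ ε a b hab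

/-! ## §2 The junk six-point functional `T` and the family `𝔖₆ = -T` -/

/-- Diagonal embedding `a ↦ (a, …, a)`. -/
def diagE : E4 →L[ℝ] (Fin 6 → E4) := ContinuousLinearMap.pi fun _ => ContinuousLinearMap.id ℝ E4

/-- Coordinates of the diagonal embedding. -/
@[simp] theorem diagE_apply (a : E4) (i : Fin 6) : diagE a i = a := rfl

/-- The diagonal translates of `Z`: `a ↦ Z + (a, …, a)`. -/
def gZ (a : E4) : Fin 6 → E4 := fun i => Z i + a

/-- Unfolding `gZ`. -/
@[simp] theorem gZ_apply (a : E4) (i : Fin 6) : gZ a i = Z i + a := rfl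

/-- `gZ` has temperate growth (constant plus linear). -/
theorem gZ_hasTemperateGrowth : Function.HasTemperateGrowth gZ := by
  have h := (Function.HasTemperateGrowth.const (E := E4) (Z : Fin 6 → E4)).add diagE.hasTemperateGrowth
  have hg : gZ = (fun _ : E4 => Z) + ⇑diagE := by
    funext a; funext i; rfl
  rw [hg]
  exact h

/-- The lower bound `‖a‖ ≤ (1 + ‖Z 0‖)(1 + ‖gZ a‖)` required by `SchwartzMap.compCLM`. -/
theorem gZ_upper : ∃ (k : ℕ) (C : ℝ), ∀ a : E4, ‖a‖ ≤ C * (1 + ‖gZ a‖) ^ k := by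
  refine ⟨1, 1 + ‖Z 0‖, fun a => ?_⟩
  have h1 : ‖Z 0 + a‖ ≤ ‖gZ a‖ := norm_le_pi_norm (gZ a) 0
  have h2 : ‖a‖ ≤ ‖Z 0 + a‖ + ‖Z 0‖ := by
    calc ‖a‖ = ‖(Z 0 + a) - Z 0‖ := by rw [add_sub_cancel_left]
      _ ≤ ‖Z 0 + a‖ + ‖Z 0‖ := norm_sub_le _ _
  rw [pow_one]
  nlinarith [norm_nonneg (Z 0), norm_nonneg (gZ a), norm_nonneg a]

/-- `λ₆ G = ∫_{ℝ⁴} G (Z + (a,…,a)) da` as a continuous linear functional. -/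
def lam6 : SchwartzMap (Fin 6 → E4) ℂ →L[ℂ] ℂ :=
  (SchwartzMap.integralCLM ℂ (volume : Measure E4)).comp
    (SchwartzMap.compCLM ℂ (g := gZ) gZ_hasTemperateGrowth gZ_upper)

/-- Unfolding `λ₆`. -/
theorem lam6_apply (G : SchwartzMap (Fin 6 → E4) ℂ) : lam6 G = ∫ a : E4, G (fun i => Z i + a) := by
  simp only [lam6, ContinuousLinearMap.comp_apply, SchwartzMap.integralCLM_apply]
  congr 1

/-- **The junk six-point functional**: the `W(B₄) × S₆`-symmetrisation of `λ₆`. -/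
def T : SchwartzMap (Fin 6 → E4) ℂ →L[ℂ] ℂ :=
  ∑ g : WIdx, ∑ π : Equiv.Perm (Fin 6), (lam6.comp (permTest π)).comp (linActMulti (sp g.1 g.2).symm)

set_option maxRecDepth 20000 in
/-- Unfolding `T` as a double sum of integrals over `ℝ⁴`. (The raised recursion depth only serves the
`sum_apply` step over the index type `W(B₄) × S₆`.) -/
theorem T_apply (G : SchwartzMap (Fin 6 → E4) ℂ) :
    T G = ∑ g : WIdx, ∑ π : Equiv.Perm (Fin 6), ∫ a : E4, G (fun i => sp g.1 g.2 (Z (π i) + a)) := by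
  simp only [T, _root_.sum_apply, ContinuousLinearMap.comp_apply,
    lam6_apply, permTest_apply, linActMulti_apply, LinearIsometryEquiv.symm_symm]
  rfl

/-- **Core vanishing lemma.** If every `W(B₄)`-preimage `m` of `w` has `m 0 = 0 ∨ m 1 = 0 ∨ m 0² = m 1²`,
then `T` kills every test function vanishing at configurations two of whose points pair equally with `w`. -/
theorem T_eq_zero_of_vanish (H : SchwartzMap (Fin 6 → E4) ℂ) (w : E4)
    (hw : ∀ (σ : Equiv.Perm (Fin 4)) (ε : Fin 4 → Bool),
      ((sp σ ε).symm w) 0 = 0 ∨ ((sp σ ε).symm w) 1 = 0 ∨ ((sp σ ε).symm w) 0 ^ 2 = ((sp σ ε).symm w) 1 ^ 2)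
    (hH : ∀ z : Fin 6 → E4, (∃ p q : Fin 6, p ≠ q ∧ ⟪z p, w⟫_ℝ = ⟪z q, w⟫_ℝ) → H z = 0) :
    T H = 0 := by
  rw [T_apply]
  refine Finset.sum_eq_zero fun g _ => Finset.sum_eq_zero fun π _ => ?_
  have hz : (fun a : E4 => H (fun i => sp g.1 g.2 (Z (π i) + a))) = fun _ => 0 := by
    funext a
    apply hH
    obtain ⟨p, q, hpq, hinner⟩ := exists_pair_Z ((sp g.1 g.2).symm w) (hw g.1 g.2)
    refine ⟨π.symm p, π.symm q, fun h => hpq (π.symm.injective h), ?_⟩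
    simp only [Equiv.apply_symm_apply]
    rw [← LinearIsometryEquiv.inner_map_map (sp g.1 g.2) (Z p),
      ← LinearIsometryEquiv.inner_map_map (sp g.1 g.2) (Z q),
      LinearIsometryEquiv.apply_symm_apply] at hinner
    rw [map_add, map_add, inner_add_left, inner_add_left, hinner]
  rw [hz]
  simp

/-- `T` is symmetric under permutations of the six arguments (re-indexing of the `S₆`-sum). -/
theorem T_permTest (π₀ : Equiv.Perm (Fin 6)) (G : SchwartzMap (Fin 6 → E4) ℂ) :
    T (permTest π₀ G) = T G := by
  rw [T_apply, T_apply]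
  refine Finset.sum_congr rfl fun g _ => ?_
  simp only [permTest_apply]
  exact Fintype.sum_equiv (Equiv.mulRight π₀) _ _ fun π => rfl

/-- `T` is invariant under diagonal translations (translation invariance of Lebesgue measure on `ℝ⁴`). -/
theorem T_translate (v : E4) (G : SchwartzMap (Fin 6 → E4) ℂ) :
    T (translateMulti v G) = T G := by
  rw [T_apply, T_apply]
  refine Finset.sum_congr rfl fun g _ => Finset.sum_congr rfl fun π _ => ?_
  simp only [translateMulti_apply]
  have key : ∀ a : E4, (fun i => sp g.1 g.2 (Z (π i) + a) - v) =
      fun i => sp g.1 g.2 (Z (π i) + (a - (sp g.1 g.2).symm v)) := by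
    intro a
    funext i
    rw [map_add, map_add, map_sub, LinearIsometryEquiv.apply_symm_apply]
    abel
  simp_rw [key]
  exact integral_sub_right_eq_self (μ := (volume : Measure E4))
    (fun a => G fun i => sp g.1 g.2 (Z (π i) + a)) _

/-- `T` is invariant under pull-back by any signed permutation (re-indexing of the `W(B₄)`-sum). -/
theorem T_sp (τ : Equiv.Perm (Fin 4)) (δ : Fin 4 → Bool) (G : SchwartzMap (Fin 6 → E4) ℂ) :
    T (linActMulti (sp τ δ).symm G) = T G := by
  rw [T_apply, T_apply]
  simp only [linActMulti_apply, LinearIsometryEquiv.symm_symm, sp_comp_apply]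
  exact Fintype.sum_equiv (shear τ δ) _ _ fun g => rfl

/-- `T` is invariant under pull-back by every isometry permuting the axes up to sign (full hypercubic
invariance of the witness; not needed for the refutation, recorded for the moral). -/
theorem T_hyper {R : E4 ≃ₗᵢ[ℝ] E4} (hR : IsHyper R) (G : SchwartzMap (Fin 6 → E4) ℂ) :
    T (linActMulti R G) = T G := by
  obtain ⟨τ, δ, hτ⟩ := exists_sp_of_isHyper hR.symm
  have : linActMulti R G = linActMulti (sp τ δ).symm G := by
    ext x
    simp only [linActMulti_apply, LinearIsometryEquiv.symm_symm, hτ]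
  rw [this, T_sp]

/-- **The witness family**: `𝔖₆ = -T`, all other `𝔖ₙ = 0`. -/
def S6 : SchwingerFamily E4
  | 6 => -T
  | _ => 0

/-- Degree six of the witness family. -/
theorem S6_six : S6 6 = -T := rfl

/-- All degrees other than `6` vanish. -/
theorem S6_of_ne {N : ℕ} (h6 : N ≠ 6) : S6 N = 0 := by
  rcases N with _ | _ | _ | _ | _ | _ | _ | N
  · rfl
  · rfl
  · rfl
  · rfl
  · rfl
  · rfl
  · exact absurd rfl h6
  · rfl

/-- Negation of a functional, pointwise (generic `rfl`, so that no witness is ever unfolded). -/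
theorem neg_clm_apply {n : ℕ} (L : SchwartzMap (Fin n → E4) ℂ →L[ℂ] ℂ) (G : SchwartzMap (Fin n → E4) ℂ) :
    (-L) G = -(L G) := rfl

/-- The whole family kills what `T` kills. -/
theorem S6_eq_zero_of_vanish {N : ℕ} (H : SchwartzMap (Fin N → E4) ℂ) (w : E4)
    (hw : ∀ (σ : Equiv.Perm (Fin 4)) (ε : Fin 4 → Bool),
      ((sp σ ε).symm w) 0 = 0 ∨ ((sp σ ε).symm w) 1 = 0 ∨ ((sp σ ε).symm w) 0 ^ 2 = ((sp σ ε).symm w) 1 ^ 2)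
    (hH : ∀ z : Fin N → E4, (∃ p q : Fin N, p ≠ q ∧ ⟪z p, w⟫_ℝ = ⟪z q, w⟫_ℝ) → H z = 0) :
    S6 N H = 0 := by
  by_cases hN : N = 6
  · subst hN
    rw [S6_six, neg_clm_apply, neg_eq_zero]
    exact T_eq_zero_of_vanish H w hw hH
  · rw [S6_of_ne hN]
    rfl

/-- E3 for the witness family, degreewise and on all test functions. -/
theorem S6_permTest (n : ℕ) (π : Equiv.Perm (Fin n)) (F : SchwartzMap (Fin n → E4) ℂ) :
    S6 n (permTest π F) = S6 n F := by
  by_cases hn : n = 6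
  · subst hn
    rw [S6_six, neg_clm_apply, neg_clm_apply, T_permTest]
  · rw [S6_of_ne hn]
    rfl

/-- Translation invariance of the witness family (all degrees, all test functions). -/
theorem S6_translate (n : ℕ) (a : E4) (F : SchwartzMap (Fin n → E4) ℂ) :
    S6 n (translateMulti a F) = S6 n F := by
  by_cases hn : n = 6
  · subst hn
    rw [S6_six, neg_clm_apply, neg_clm_apply, T_translate]
  · rw [S6_of_ne hn]
    rfl

/-- Full hypercubic invariance of the witness family (all degrees, all test functions). -/
theorem S6_hyper (n : ℕ) {R : E4 ≃ₗᵢ[ℝ] E4} (hR : IsHyper R) (F : SchwartzMap (Fin n → E4) ℂ) :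
    S6 n (linActMulti R F) = S6 n F := by
  by_cases hn : n = 6
  · subst hn
    rw [S6_six, neg_clm_apply, neg_clm_apply, T_hyper hR]
  · rw [S6_of_ne hn]
    rfl

/-- **Reflection positivity in pull-back form for EVERY frame `R e₀ = a e₀ + b e₁` with
`a = 0 ∨ b = 0 ∨ a² = b²`** (in particular the eight frames of the crux): every OS matrix entry vanishes,
because `θF* ⊗ G` with `F, G` time-ordered in the frame lives on configurations with pairwise distinct
`R e₀`-components, while the support of `T` has an equal pair in every such direction. -/
theorem S6_frame_rp (R : E4 ≃ₗᵢ[ℝ] E4) (a b : ℝ) (hab : a = 0 ∨ b = 0 ∨ a ^ 2 = b ^ 2)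
    (hR : R (EuclideanSpace.single 0 1) = a • EuclideanSpace.single 0 1 + b • EuclideanSpace.single 1 1) :
    (SchwingerFamily.toLabelled (fun n => (S6 n).comp (linActMulti R))).IsReflectionPositive := by
  intro N deg lab F hF H hH
  have hterm : ∀ i j, (SchwingerFamily.toLabelled fun n => (S6 n).comp (linActMulti R))
      (deg i + deg j) (Fin.append (lab i ∘ Fin.rev) (lab j)) (H i j) = 0 := by
    intro i j
    simp only [SchwingerFamily.toLabelled_apply, ContinuousLinearMap.comp_apply]
    refine S6_eq_zero_of_vanish _ (R (EuclideanSpace.single 0 1)) (frame_hw R a b hab hR) ?_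
    intro z hz
    rw [linActMulti_apply]
    apply append_apply_eq_zero (timeSep_of_isTimeOrdered (hF i)) (timeSep_of_isTimeOrdered (hF j)) (hH i j)
    obtain ⟨p, q, hpq, h⟩ := hz
    exact ⟨p, q, hpq, by rw [symm_apply_zero, symm_apply_zero, h]⟩
  simp only [hterm, Finset.sum_const_zero, Complex.zero_re, Complex.zero_im, le_refl, and_self]

/-- The eight-frame RP hypothesis of the crux (Sketch form) for the witness family. -/
theorem S6_eightFrameRP : EightFrameRP S6 := fun R a b _ hab hR => S6_frame_rp R a b hab hR

/-! ## §3 The quarter-turn and the anti-diagonal mirror -/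

/-- The hypercubic quarter-turn `R_q : e₀ ↦ -e₁, e₁ ↦ e₀` (fixing `e₂, e₃`), as a signed permutation. -/
def Rq : E4 ≃ₗᵢ[ℝ] E4 := sp (Equiv.swap 0 1) fun i => decide (i = 0)

/-- `(R_q⁻¹ x)₀ = -x₁`. -/
@[simp] theorem Rq_symm_apply0 (x : E4) : Rq.symm x 0 = -x 1 := by
  simp [Rq, sp_symm_apply, sgn]
/-- `(R_q⁻¹ x)₁ = x₀`. -/
@[simp] theorem Rq_symm_apply1 (x : E4) : Rq.symm x 1 = x 0 := by
  simp [Rq, sp_symm_apply, sgn, Equiv.swap_apply_def]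
/-- `(R_q⁻¹ x)₂ = x₂`. -/
@[simp] theorem Rq_symm_apply2 (x : E4) : Rq.symm x 2 = x 2 := by
  simp [Rq, sp_symm_apply, sgn, Equiv.swap_apply_def]
/-- `(R_q⁻¹ x)₃ = x₃`. -/
@[simp] theorem Rq_symm_apply3 (x : E4) : Rq.symm x 3 = x 3 := by
  simp [Rq, sp_symm_apply, sgn, Equiv.swap_apply_def]

/-- `R_q⁻¹ ∘ θ₀` is the anti-diagonal mirror `Θ' : (a, b) ↦ (-b, -a)` on the plane. -/
theorem Rq_symm_theta_pt (a b : ℝ) : Rq.symm (timeReflection 4 (pt a b)) = pt (-b) (-a) := by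
  ext k
  fin_cases k <;> simp [timeReflection_apply]

/-- Coordinates of a point of a closed unit ball are within `1` of the centre's. -/
theorem coord_of_mem_closedBall {v c : E4} (h : v ∈ Metric.closedBall c 1) (k : Fin 4) :
    c k - 1 ≤ v k ∧ v k ≤ c k + 1 := by
  have h1 : |(v - c) k| ≤ ‖v - c‖ := by simpa [Real.norm_eq_abs] using PiLp.norm_apply_le (v - c) k
  have h2 : ‖v - c‖ ≤ 1 := by simpa [dist_eq_norm] using h
  rw [PiLp.sub_apply] at h1
  obtain ⟨h3, h4⟩ := abs_le.1 (h1.trans h2)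
  constructor <;> linarith

end Summit.QuantumFields.YangMills.Theorems.NPointIsotropy.Negative.Triage3g2

end
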